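import Summits.CriticalPhenomena.CardyFormulaZ2.Theorems.StripClusterRates.Negative.RateWindow
import Summits.CriticalPhenomena.CardyFormulaZ2.Theorems.CardyBoundaryCoulombGasStripClusterRatesOfCardyFormulaZ2
import Summits.CriticalPhenomena.CardyFormulaZ2.Theorems.CardyBoundaryCoulombGasStripClusterRatesBandEvent
import Summits.CriticalPhenomena.CardyFormulaZ2.Theorems.CardyBoundaryCoulombGasStripClusterRatesBandIndependence
import Summits.CriticalPhenomena.CardyFormulaZ2.Theorems.CardyBoundaryCoulombGasStripClusterRatesBandRateSum
import Summits.CriticalPhenomena.CardyFormulaZ2.Theorems.CardyBoundaryCoulombGasStripClusterRatesBandLimitWindow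
import Summits.CriticalPhenomena.CardyFormulaZ2.Theorems.CardyBoundaryCoulombGasStripClusterRatesBandLimitKac

/-!
# The two-sided window for the two-cluster constant of `StripClusterRates`:
# `2 log 2 ≤ lim n·γ₂(n) ≤ 144 log 2` unconditionally, `2π/3 ≤ lim n·γ₂(n) ≤ 3π` under the conjunct

Support file for line `two-cluster-rate-is-stationary-gap` (crux `StripClusterRates`,
stmt-CriticalPhenomena-13878), lead c5. The crux asserts `n·γ₁(n) → π/3` and `n·γ₂(n) → 2π` for the
lengthwise rates of "one spanning cluster" / "two distinct spanning clusters" of bond percolation on `ℤ²` at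
`p = 1/2` in the free strip of width `n`. The γ₁-half is a corollary of the conjunct `CardyFormulaZ2`
(`oneClusterKac_of_cardyFormulaZ2`, lead c4) and the γ₂-half is the open Kac-gap statement K₂. What RSW
technology CAN say about the γ₂-half is assembled here from the BAND CONSTRUCTION (registered sub-goals
`band_twoClusterEvent_of_crossings`, `band_real_inter_eq`, `band_rate_le_of_prod_le`,
`band_nMul_rateTwo_limit_le`, `band_nMul_rateTwo_limit_le_three_pi`, all landed in the `…Band*` files):

* §1 `band_pTwo_ge : p₁(m,a)·p₁(m,b)·p₁(m+1,c) ≤ p₂(m, a+b+c+3)` — two open LR crossings of the outer bands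
  and no open top-bottom crossing of the middle band (probability `p₁(m+1,c)` by duality) give two spanning
  clusters that are distinct inside the rectangle; the three bands are independent.
* §2 `band_rateTwo_le : γ₂(a+b+c+3) ≤ γ₁(a) + γ₁(b) + γ₁(c)` and `band_rateTwo_le_three_mul :
  γ₂(3h+3) ≤ 3γ₁(h)` — the STRUCTURAL INEQUALITY between the two rate functions of the crux.
* §3 THE UNCONDITIONAL WINDOW `nMul_rateTwo_limit_mem_window : 2 log 2 ≤ L₂ ≤ 144 log 2` for every family of
  rates as in the crux and every limit `L₂` of `n·γ₂(n)` (lower edge: BK, `Negative.RateWindow`; upper edge: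
  §2 + the RSW bound `γ₁(2j+1) ≤ 8 log 2/(j+1)` of `Negative.KacFromAboveFalse`) — Aizenman's theorem
  (Nucl. Phys. B 485 (1997), Thm 3: `e^{-α n² k} ≲ P(n,k) ≲ e^{-α' n² k}`) for `n = 2` spanning clusters in
  transfer-matrix order of limits; the crux's `2π = 6.28…` lies inside `[1.38…, 99.8…]`.
* §4 THE CONDITIONAL WINDOW: under the γ₁-half ALONE (hence under `CardyFormulaZ2`), `2π/3 ≤ L₂ ≤ 3π`
  (`nMul_rateTwo_limit_mem_window_of_kacOne`, `twoCluster_window_of_cardyFormulaZ2`): the conjunct the route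
  serves localises the two-cluster constant to `[2.09…, 9.42…]` but does not decide it — consistent with the
  census that K₂ (`= 2π`) is logically beyond the conjunct by every known argument.

No definitions are introduced; `pOne`, `pTwo`, `rateSeqOne`, `rateSeqTwo`, `twoClusterEvent` are the
abbreviations of `Negative.KacFromAboveFalse`.

References: [Aizenman1997] Thm 3; [Cardy1998] eq. (bb); Bollobás–Riordan, *Percolation* (2006), Ch. 3.
-/

noncomputable section

open MeasureTheory Filter Topology
open Literature.Probability.LatticeModels Literature.Probability.Percolation

namespace Summit.CriticalPhenomena.CardyFormulaZ2.Cruxes.StripClusterRates.TwoClusterRateIsStationaryGap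

open Summit.CriticalPhenomena.CardyFormulaZ2.Theorems.StripClusterRates.Negative

/-! ## §1 The band lower bound on `p₂` -/

/-- **Band lower bound for two distinct spanning clusters**: for all `m, a, b, c`,
`p₁(m,a) · p₁(m,b) · p₁(m+1,c) ≤ p₂(m, a+b+c+3)` — open LR crossings of the bottom `a`-band and of the top
`b`-band together with the absence of an open top-bottom crossing of the middle `(c+1)`-band (an event of
probability `1 − P[TB] = p₁(m+1,c)` by duality) force the two-cluster event, and the three bands are
independent. (Aizenman 1997, proof of Thm 3, lower bound, for `n = 2`.) [cite: Aizenman1997, Thm 3] -/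
theorem band_pTwo_ge : ∀ m a b c : ℕ, crossingProb half m a * crossingProb half m b * crossingProb half (m + 1) c ≤ (bondPercolation (zdGraph 2) half).real {ω | ∃ x₁ ∈ (leftSide m (a + b + c + 3) : Set (Site 2)), ∃ y₁ ∈ (rightSide m (a + b + c + 3) : Set (Site 2)), ∃ x₂ ∈ (leftSide m (a + b + c + 3) : Set (Site 2)), ∃ y₂ ∈ (rightSide m (a + b + c + 3) : Set (Site 2)), ω ∈ openConnIn (rectangle m (a + b + c + 3) : Set (Site 2)) x₁ y₁ ∧ ω ∈ openConnIn (rectangle m (a + b + c + 3) : Set (Site 2)) x₂ y₂ ∧ ω ∉ openConnIn (rectangle m (a + b + c + 3) : Set (Site 2)) x₁ x₂} := by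
  intro m a b c
  rw [← band_real_inter_eq m a b c]
  refine ENNReal.toReal_mono (measure_ne_top _ _) (measure_mono_ae ?_)
  filter_upwards [ae_subset_edgeSet (zdGraph 2) half] with ω hω h
  exact band_twoClusterEvent_of_crossings m a b c ω hω h.1.1 h.1.2 h.2

/-- `band_pTwo_ge` in the vocabulary of `Negative.KacFromAboveFalse`:
`pOne m a * pOne m b * pOne (m+1) c ≤ pTwo m (a+b+c+3)`. [cite: Aizenman1997, Thm 3] -/
theorem band_pTwo_ge' (m a b c : ℕ) : pOne m a * pOne m b * pOne (m + 1) c ≤ pTwo m (a + b + c + 3) :=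
  band_pTwo_ge m a b c

/-! ## §2 The structural rate inequality `γ₂(a+b+c+3) ≤ γ₁(a) + γ₁(b) + γ₁(c)` -/

/-- **Band inequality between the two rate functions of the crux**: for any widths `a, b, c` and any
rates `γ₁(a), γ₁(b), γ₁(c)` (one cluster) and `γ₂(a+b+c+3)` (two distinct clusters),
`γ₂(a+b+c+3) ≤ γ₁(a) + γ₁(b) + γ₁(c)` (from `band_pTwo_ge`, taking `-log(·)/m` and `m → ∞`; the middle
factor `p₁(m+1,c)` has the same rate `γ₁(c)`). [cite: Aizenman1997, Thm 3] -/
theorem band_rateTwo_le {a b c : ℕ} {γa γb γc γ₂ : ℝ} (ha : Tendsto (rateSeqOne a) atTop (𝓝 γa))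
    (hb : Tendsto (rateSeqOne b) atTop (𝓝 γb)) (hc : Tendsto (rateSeqOne c) atTop (𝓝 γc))
    (h₂ : Tendsto (rateSeqTwo (a + b + c + 3)) atTop (𝓝 γ₂)) : γ₂ ≤ γa + γb + γc :=
  band_rate_le_of_prod_le a b c (fun m ↦ pTwo m (a + b + c + 3)) γa γb γc γ₂ (band_pTwo_ge' · a b c)
    ha hb hc h₂

/-- **Equal bands**: `γ₂(3h+3) ≤ 3·γ₁(h)` for every `h ≥ 1`, for any families of rates as in the crux. [cite: Aizenman1997, Thm 3] -/
theorem band_rateTwo_le_three_mul {γ₁ γ₂ : ℕ → ℝ}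
    (h₁ : ∀ n : ℕ, 1 ≤ n → Tendsto (rateSeqOne n) atTop (𝓝 (γ₁ n)))
    (h₂ : ∀ n : ℕ, 1 ≤ n → Tendsto (rateSeqTwo n) atTop (𝓝 (γ₂ n))) :
    ∀ h : ℕ, 1 ≤ h → γ₂ (3 * h + 3) ≤ 3 * γ₁ h := by
  intro h hh
  have := band_rateTwo_le (h₁ h hh) (h₁ h hh) (h₁ h hh) (h₂ (h + h + h + 3) (by omega))
  rw [show 3 * h + 3 = h + h + h + 3 by ring]
  linarith

/-- **Uneven bands, monotone form**: for `n ≥ 3h + 3` with `h ≥ 1`, `γ₂(n) ≤ 3·γ₁(h)` — split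
`n = h + h + (n − 2h − 3) + 3` and use that `γ₁` is antitone in the width (`rateOne_antitone`). [cite: Aizenman1997, Thm 3] -/
theorem band_rateTwo_le_three_mul_of_le {γ₁ γ₂ : ℕ → ℝ}
    (h₁ : ∀ n : ℕ, 1 ≤ n → Tendsto (rateSeqOne n) atTop (𝓝 (γ₁ n)))
    (h₂ : ∀ n : ℕ, 1 ≤ n → Tendsto (rateSeqTwo n) atTop (𝓝 (γ₂ n))) {h n : ℕ} (hh : 1 ≤ h)
    (hn : 3 * h + 3 ≤ n) : γ₂ n ≤ 3 * γ₁ h := by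
  obtain ⟨c, hc, rfl⟩ : ∃ c, h ≤ c ∧ n = h + h + c + 3 := ⟨n - 2 * h - 3, by omega, by omega⟩
  have hγc := rateOne_antitone hc (h₁ h hh) (h₁ c (by omega))
  have := band_rateTwo_le (h₁ h hh) (h₁ h hh) (h₁ c (by omega)) (h₂ (h + h + c + 3) (by omega))
  linarith

/-! ## §3 The unconditional window `2 log 2 ≤ lim n·γ₂(n) ≤ 144 log 2` -/

/-- **Upper edge of the two-cluster window (RSW)**: for any rate functions `γ₁, γ₂` as in the crux and any
limit `L₂` of `n·γ₂(n)`, `L₂ ≤ 144 log 2 ≈ 99.8` (along `n = 3h+3`: `n·γ₂(n) ≤ 9(h+1)γ₁(h) ≤ 144 log 2`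
by `γ₁(h) ≤ 16 log 2/(h+1)`, from `rateOne_odd_width_le` and `rateOne_antitone`). The crux claims
`L₂ = 2π ≈ 6.28`. (Aizenman 1997, Thm 3, upper constant `α`, for `n = 2`, transfer-matrix order.) [cite: Aizenman1997, Thm 3] -/
theorem nMul_rateTwo_limit_le {γ₁ γ₂ : ℕ → ℝ}
    (h₁ : ∀ n : ℕ, 1 ≤ n → Tendsto (rateSeqOne n) atTop (𝓝 (γ₁ n)))
    (h₂ : ∀ n : ℕ, 1 ≤ n → Tendsto (rateSeqTwo n) atTop (𝓝 (γ₂ n))) {L₂ : ℝ}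
    (hL : Tendsto (fun n : ℕ ↦ (n : ℝ) * γ₂ n) atTop (𝓝 L₂)) : L₂ ≤ 144 * Real.log 2 :=
  band_nMul_rateTwo_limit_le γ₁ γ₂ h₁ (band_rateTwo_le_three_mul h₁ h₂) L₂ hL

/-- **THE TWO-CLUSTER WINDOW**: `2 log 2 ≤ lim n·γ₂(n) ≤ 144 log 2`, i.e. `L₂ ∈ [1.386…, 99.8…]`, for
every pair of rate functions of the crux and every limit (lower edge: BK `p₂ ≤ p₁²` and self-duality,
`nMul_rateTwo_limit_ge`; upper edge: the band construction). Aizenman's theorem for two spanning clusters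
in transfer-matrix order; the crux's `2π` is strictly inside, so RSW/BK/duality cannot decide it. [cite: Aizenman1997, Thm 3] -/
theorem nMul_rateTwo_limit_mem_window {γ₁ γ₂ : ℕ → ℝ}
    (h₁ : ∀ n : ℕ, 1 ≤ n → Tendsto (rateSeqOne n) atTop (𝓝 (γ₁ n)))
    (h₂ : ∀ n : ℕ, 1 ≤ n → Tendsto (rateSeqTwo n) atTop (𝓝 (γ₂ n))) {L₂ : ℝ}
    (hL : Tendsto (fun n : ℕ ↦ (n : ℝ) * γ₂ n) atTop (𝓝 L₂)) :
    2 * Real.log 2 ≤ L₂ ∧ L₂ ≤ 144 * Real.log 2 :=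
  ⟨nMul_rateTwo_limit_ge h₁ h₂ hL, nMul_rateTwo_limit_le h₁ h₂ hL⟩

/-- The crux's two-cluster constant sits strictly inside the unconditional window:
`2 log 2 < 2π < 144 log 2`. [folklore] -/
theorem two_pi_mem_window : 2 * Real.log 2 < 2 * Real.pi ∧ 2 * Real.pi < 144 * Real.log 2 := by
  have h1 := Real.log_two_lt_d9
  have h2 := Real.log_two_gt_d9
  have h3 := Real.pi_gt_three
  have h4 := Real.pi_lt_d2
  constructor <;> nlinarith

/-! ## §4 The conditional window `2π/3 ≤ lim n·γ₂(n) ≤ 3π` under the γ₁-half (hence under the conjunct) -/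

/-- **Lower edge under the γ₁-half**: if `n·γ₁(n) → π/3` then every limit `L₂` of `n·γ₂(n)` has
`2π/3 ≤ L₂` (BK: `γ₂(n) ≥ 2γ₁(n)`, `rateTwo_ge_two_mul_rateOne`). [folklore] -/
theorem nMul_rateTwo_limit_ge_of_kacOne {γ₁ γ₂ : ℕ → ℝ}
    (h₁ : ∀ n : ℕ, 1 ≤ n → Tendsto (rateSeqOne n) atTop (𝓝 (γ₁ n)))
    (h₂ : ∀ n : ℕ, 1 ≤ n → Tendsto (rateSeqTwo n) atTop (𝓝 (γ₂ n)))
    (hK₁ : Tendsto (fun n : ℕ ↦ (n : ℝ) * γ₁ n) atTop (𝓝 (Real.pi / 3))) {L₂ : ℝ}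
    (hL : Tendsto (fun n : ℕ ↦ (n : ℝ) * γ₂ n) atTop (𝓝 L₂)) : 2 * Real.pi / 3 ≤ L₂ := by
  have hlim : Tendsto (fun n : ℕ ↦ 2 * ((n : ℝ) * γ₁ n)) atTop (𝓝 (2 * (Real.pi / 3))) := hK₁.const_mul 2
  rw [show 2 * Real.pi / 3 = 2 * (Real.pi / 3) by ring]
  refine le_of_tendsto_of_tendsto hlim hL ?_
  filter_upwards [eventually_ge_atTop 1] with n hn
  have := rateTwo_ge_two_mul_rateOne hn (h₁ n hn) (h₂ n hn)
  have h0 : (0 : ℝ) ≤ n := by positivity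
  nlinarith

/-- **Upper edge under the γ₁-half**: if `n·γ₁(n) → π/3` then every limit `L₂` of `n·γ₂(n)` has
`L₂ ≤ 3π` (along `n = 3h+3`: `n·γ₂(n) ≤ 9(h+1)γ₁(h) → 3π`). [folklore] -/
theorem nMul_rateTwo_limit_le_of_kacOne {γ₁ γ₂ : ℕ → ℝ}
    (h₁ : ∀ n : ℕ, 1 ≤ n → Tendsto (rateSeqOne n) atTop (𝓝 (γ₁ n)))
    (h₂ : ∀ n : ℕ, 1 ≤ n → Tendsto (rateSeqTwo n) atTop (𝓝 (γ₂ n)))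
    (hK₁ : Tendsto (fun n : ℕ ↦ (n : ℝ) * γ₁ n) atTop (𝓝 (Real.pi / 3))) {L₂ : ℝ}
    (hL : Tendsto (fun n : ℕ ↦ (n : ℝ) * γ₂ n) atTop (𝓝 L₂)) : L₂ ≤ 3 * Real.pi :=
  band_nMul_rateTwo_limit_le_three_pi γ₁ γ₂ (band_rateTwo_le_three_mul h₁ h₂) hK₁ L₂ hL

/-- **THE CONDITIONAL WINDOW**: under the γ₁-half of the crux, `2π/3 ≤ lim n·γ₂(n) ≤ 3π`, i.e.
`L₂ ∈ [2.09…, 9.42…]`; the crux claims `2π = 6.28…`. [folklore] -/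
theorem nMul_rateTwo_limit_mem_window_of_kacOne {γ₁ γ₂ : ℕ → ℝ}
    (h₁ : ∀ n : ℕ, 1 ≤ n → Tendsto (rateSeqOne n) atTop (𝓝 (γ₁ n)))
    (h₂ : ∀ n : ℕ, 1 ≤ n → Tendsto (rateSeqTwo n) atTop (𝓝 (γ₂ n)))
    (hK₁ : Tendsto (fun n : ℕ ↦ (n : ℝ) * γ₁ n) atTop (𝓝 (Real.pi / 3))) {L₂ : ℝ}
    (hL : Tendsto (fun n : ℕ ↦ (n : ℝ) * γ₂ n) atTop (𝓝 L₂)) :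
    2 * Real.pi / 3 ≤ L₂ ∧ L₂ ≤ 3 * Real.pi :=
  ⟨nMul_rateTwo_limit_ge_of_kacOne h₁ h₂ hK₁ hL, nMul_rateTwo_limit_le_of_kacOne h₁ h₂ hK₁ hL⟩

/-- **The conjunct localises the two-cluster constant to `[2π/3, 3π]`** (registered sub-goal
`twoCluster_window_of_cardyFormulaZ2`): under `CardyFormulaZ2`, for every pair of rate functions `γ₁, γ₂`
as in the crux (one cluster / two distinct clusters, `n ≥ 1`) and every limit `L₂` of `n·γ₂(n)`,
`2π/3 ≤ L₂ ≤ 3π` — the γ₁-half holds by `oneClusterKac_of_cardyFormulaZ2` (lead c4), then §4. The crux's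
value `2π` (K₂) is inside and is NOT decided by the conjunct through this (or any known) argument. [cite: Cardy1998, eq. (bb)] -/
theorem twoCluster_window_of_cardyFormulaZ2 : _root_.CardyFormulaZ2 → ∀ γ₁ γ₂ : ℕ → ℝ, (∀ n : ℕ, 1 ≤ n → Tendsto (fun m : ℕ ↦ -Real.log (crossingProb half m n) / (m : ℝ)) atTop (𝓝 (γ₁ n))) → (∀ n : ℕ, 1 ≤ n → Tendsto (fun m : ℕ ↦ -Real.log ((bondPercolation (zdGraph 2) half).real {ω | ∃ x₁ ∈ (leftSide m n : Set (Site 2)), ∃ y₁ ∈ (rightSide m n : Set (Site 2)), ∃ x₂ ∈ (leftSide m n : Set (Site 2)), ∃ y₂ ∈ (rightSide m n : Set (Site 2)), ω ∈ openConnIn (rectangle m n : Set (Site 2)) x₁ y₁ ∧ ω ∈ openConnIn (rectangle m n : Set (Site 2)) x₂ y₂ ∧ ω ∉ openConnIn (rectangle m n : Set (Site 2)) x₁ x₂}) / (m : ℝ)) atTop (𝓝 (γ₂ n))) → ∀ L₂ : ℝ, Tendsto (fun n : ℕ ↦ (n : ℝ) * γ₂ n) atTop (𝓝 L₂) → 2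 * Real.pi / 3 ≤ L₂ ∧ L₂ ≤ 3 * Real.pi :=
  fun h γ₁ _ h₁ h₂ _ hL =>
    nMul_rateTwo_limit_mem_window_of_kacOne h₁ h₂ (oneClusterKac_of_cardyFormulaZ2 h γ₁ h₁) hL

/-- The crux's two-cluster constant sits strictly inside the conditional window: `2π/3 < 2π < 3π`. [folklore] -/
theorem two_pi_mem_conditional_window : 2 * Real.pi / 3 < 2 * Real.pi ∧ 2 * Real.pi < 3 * Real.pi := by
  constructor <;> nlinarith [Real.pi_pos]

/-- **Readback against the crux**: `StripClusterRates` provides rate functions that obey every bound of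
this file — in particular `γ₂(a+b+c+3) ≤ γ₁(a)+γ₁(b)+γ₁(c)` for all `a, b, c ≥ 1` — together with the
two Kac limits. (True implication; recorded so that the band inequality is visible on the crux's own
objects.) [cite: Cardy1998, eq. (bb)] -/
theorem stripClusterRates_band_inequality
    (h : Summit.CriticalPhenomena.CardyFormulaZ2.Theses.CardyBoundaryCoulombGas.StripClusterRates) :
    ∃ γ₁ γ₂ : ℕ → ℝ,
      (∀ a b c : ℕ, 1 ≤ a → 1 ≤ b → 1 ≤ c → γ₂ (a + b + c + 3) ≤ γ₁ a + γ₁ b + γ₁ c) ∧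
      Tendsto (fun n : ℕ ↦ (n : ℝ) * γ₁ n) atTop (𝓝 (Real.pi / 3)) ∧
      Tendsto (fun n : ℕ ↦ (n : ℝ) * γ₂ n) atTop (𝓝 (2 * Real.pi)) := by
  obtain ⟨γ₁, γ₂, h1, h2, h3, h4⟩ := h
  exact ⟨γ₁, γ₂, fun a b c ha hb hc ↦
    band_rateTwo_le (h1 a ha) (h1 b hb) (h1 c hc) (h2 (a + b + c + 3) (by omega)), h3, h4⟩

end Summit.CriticalPhenomena.CardyFormulaZ2.Cruxes.StripClusterRates.TwoClusterRateIsStationaryGap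

end
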